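import Summits.QuantumFields.YangMills.Theorems.BalabanUVNodesN06HHLegAtPinsPhysRU
import Literature.MathematicalPhysics.QuantumFieldTheory.Balaban1983to89.B9Thm313WholeQstarFromG0

/-!
# BalabanUVNodes ∕ N06 ([B9], `Dag.B9_main`) — CASCADE-K PIECE K2 (director-ym №383): rows 20–21's `LettersHHZ` LETTER `hLHH` (`…N06HHLegAtPinsPhysRU`) RE-PRESSED ONCE
# WITH THE AVERAGING LETTER's `Q⋆`-MAJORANT DISPLAYED (no pin to the straight pair)

Track A of `YM-PLAN.md` (cell `pub-ymgap`, HUMAN RULING D-0062), node **N06** = [Balaban1985BackgroundPropagators] Thms 3.1–3.15; seat `pub-ymgap-dag-n06-d` (gen 24).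
WHY.  `hLHH_of_pinsRU` (✓) pins the Sect.-D record's `Q⋆(U)` to the STRAIGHT averaging pair (`hQsco12 : (𝔬12 x).Qstar U = QscoKH … (parBY …) U`) and reads its block
majorant from dag-n06-w5's `hasMaj_Qstar_pins` ((3.24) for that pair).  The knit certificate's record carries PRINT's averaging `Q(U)` of (3.115) and its trace adjoint
`Q†(U)` (node00-def-Y `qsKnitOfRecord`), whose (3.24)-type sizes are dag-n06-c's (L7).  This file is the ONE parametric re-press: the `Q⋆`-majorant is a DISPLAYED LAW
`hqsK : … Reg335 c35 α₀ U → HasMaj (weightNorm …) (cNorm 1 (H x) (𝔬12 x).blk … 0) ((𝔬12 x).Qstar U) (BQ·e^{−δQ d})` (`BQ ≥ 0`, `δQ ≥ δ12₃ + 1`), read against the record's own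
block maps (so the `hblk12 ∕ hblkZ12 ∕ hQsco12` pins disappear); dag-n06-l's engine `B9Thm313WholeQstarFromG0.pQ_of_h43` and `letters313DMZ_mono` verbatim; witness
`Bq⋆ β := max (Bq12 β) (Bh12 β·BQ·c)`.  Instances: today's `(parBY, QscoKH)` by `hasMaj_Qstar_pins` (`BQ := e^{δQ(ℓ+4)}`); the knit pair by dag-n06-c's (L7) sizes.
★★ `hLHH_of_pinsRU_par`.  HONEST FRAMING.  Mechanical re-press; `h33 hqsK` and the `DMZ` schema stay HYPOTHESES; nothing of [B9] asserted; COUNT-NEUTRAL; N06 NOT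
discharged; K1⁹ NOT closed; one finite 𝕋⁴ programme at fixed `ε` — NOT continuum ∕ OS ∕ mass gap ∕ Clay.  0 `def`, 0 `sorry`.
[cite: Balaban1985BackgroundPropagators, (3.132)–(3.133) p.422, (3.126) p.420, (3.24) p.394, (3.115) p.418, Thm 3.3 (3.43) p.398, (3.35)–(3.36) p.396, Thm 3.13 p.426;
Balaban1985Averaging, Prop. 2 p.26; Balaban1984PropagatorsII, (2.51)–(2.56) pp.232–233, Lemma 2.1 (2.61) p.234]
-/

noncomputable section

namespace Summit.QuantumFields.YangMills.BalabanUVNodes.N06HHLegAtPinsPhysRUPar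

open Literature.MathematicalPhysics.QuantumFieldTheory.Balaban1983to89
open Literature.MathematicalPhysics.QuantumFieldTheory.Balaban1983to89.Node00 (FBondY IBondY parBY)
open Literature.MathematicalPhysics.QuantumFieldTheory.Balaban1983to89.B9Thm34Ext (toB6)
open Literature.MathematicalPhysics.QuantumFieldTheory.Balaban1983to89.B11SectG (HasMaj BlockNorm RowSum)
open Literature.MathematicalPhysics.QuantumFieldTheory.Balaban1983to89.B9SectDSup (weightNorm)
open Literature.MathematicalPhysics.QuantumFieldTheory.Balaban1983to89.B9RWSums343Holder (HolderProbes)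
open Literature.MathematicalPhysics.QuantumFieldTheory.Balaban1983to89.B9Thm312WholeDir (Thm33G0Dir)
open Literature.MathematicalPhysics.QuantumFieldTheory.Balaban1983to89.B9Thm312WholeHZ (LettersHHZ)
open Literature.MathematicalPhysics.QuantumFieldTheory.Balaban1983to89.B9CoReadingCoords (XBK blkBK)
open Literature.MathematicalPhysics.QuantumFieldTheory.Balaban1983to89.B9CoReadingCoordsS (XSK)
open Literature.MathematicalPhysics.QuantumFieldTheory.Balaban1983to89.B9CoReadingCoordsH (XHK blkHK)
open Literature.MathematicalPhysics.QuantumFieldTheory.Balaban1983to89.B9CoReadingCoordsTranspose (TrIdx trBasis)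
open Literature.MathematicalPhysics.QuantumFieldTheory.Balaban1983to89.B9LettersZSchemasMono (letters313DMZ_mono)
open Literature.MathematicalPhysics.QuantumFieldTheory.Balaban1983to89.B9Thm313WholeDirZ (Letters313DMZ)
open Literature.MathematicalPhysics.QuantumFieldTheory.Balaban1983to89.B9GeoLemma21KLevelV1 (geo9Y_dist_triangle geo9Y_dist_comm)
open Literature.MathematicalPhysics.QuantumFieldTheory.Balaban1983to89.B9GeoNormsKLevelV1 (geo9K_dist_nonneg)
open Literature.MathematicalPhysics.QuantumFieldTheory.Balaban1983to89.B9LettersHZAtOne (plateau_pos)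
open Literature.MathematicalPhysics.QuantumFieldTheory.Balaban1983to89.B9PinMembersKLevelV1 (MemberY geo9Y bg9Y)
open Literature.MathematicalPhysics.QuantumFieldTheory.Balaban1983to89.B9BackgroundsKLevelV1R (RegFamY bg9YR)
open Literature.MathematicalPhysics.QuantumFieldTheory.Balaban1983to89.B9GeoLemma21KLevelV1 (geo9Y_len_pos rowSum261_geo9Y)
open Literature.MathematicalPhysics.QuantumFieldTheory.Balaban1983to89.B7Prop2SpecialUnitary (specialUnitaryUnits)
open Literature.MathematicalPhysics.QuantumFieldTheory.Balaban1983to89.B6GlobalChartV1 (blkV1)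
open Literature.MathematicalPhysics.QuantumFieldTheory.Balaban1983to89.B6Ineq2142KLevelV1 (β lvl)
open Literature.MathematicalPhysics.QuantumFieldTheory.Balaban1983to89.B6Geom246MultiLevelTorus (geomT)
open scoped Matrix.Norms.L2Operator
open Literature.MathematicalPhysics.QuantumFieldTheory.Balaban1983to89.B9Thm313WholeQstarFromG0 (pQ_of_h43)
open Literature.MathematicalPhysics.QuantumFieldTheory.Balaban1983to89.B9Thm312Whole (GeoOK)
open Literature.MathematicalPhysics.QuantumFieldTheory.Balaban1983to89.B9Thm312Whole (cNorm)

variable {d ℓ : ℕ} {hd : 1 ≤ d + 1} {hL : Odd (ℓ + 1) ∧ 1 < ℓ + 1} {b₀ b₁ : ℝ} {Mstar : ℕ} {N : ℕ}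
variable [∀ x : MemberY d ℓ hd hL b₀ b₁ Mstar, Fintype (geo9Y x).Site]

/-- ★★ **`hLHH` AT THE MEMBERS WITH THE `Q⋆`-MAJORANT DISPLAYED** (module docstring): `hLHH_of_pinsRU` minus the straight-pair pin, plus the law `hqsK`; witnesses `MQ := max M₀ ML`,
`Bq⋆ β := max (Bq12 β) (Bh12 β·BQ·c)`.
[cite: Balaban1985BackgroundPropagators, (3.132)–(3.133) p.422 + (3.24) p.394 + Thm 3.3 (3.43) p.398 + Thm 3.13 p.426; Balaban1984PropagatorsII, (2.51)–(2.56) pp.232–233 + Lemma 2.1 (2.61) p.234] -/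
theorem hLHH_of_pinsRU_par {R₁ R₂ : RegFamY d ℓ hd hL b₀ b₁ Mstar (Matrix (Fin N) (Fin N) ℂ)} {PX PY : MemberY d ℓ hd hL b₀ b₁ Mstar → Type} [∀ x, Fintype (PX x)] [∀ x, Fintype (PY x)]
    (H : MemberY d ℓ hd hL b₀ b₁ Mstar → Prop)
    (𝔭A : ∀ x : MemberY d ℓ hd hL b₀ b₁ Mstar, HolderProbes (geo9Y x) (bg9YR (Matrix (Fin N) (Fin N) ℂ) (specialUnitaryUnits (Fin N)) R₁ R₂ x) (XBK (TrIdx N) x.toKIdx)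
      (XBK (TrIdx N) x.toKIdx) (PX x) (PY x))
    (Dd Dds : ∀ x : MemberY d ℓ hd hL b₀ b₁ Mstar, (bg9YR (Matrix (Fin N) (Fin N) ℂ) (specialUnitaryUnits (Fin N)) R₁ R₂ x).Cfg → Fin (d + 1) →
      Module.End ℝ (XBK (TrIdx N) x.toKIdx → ℝ))
    (bHXA : ∀ x : MemberY d ℓ hd hL b₀ b₁ Mstar, ℝ → BlockNorm (toB6 (geo9Y x) 1 (H x)) ((XBK (TrIdx N) x.toKIdx) → ℝ))
    (𝔬12 : ∀ x : MemberY d ℓ hd hL b₀ b₁ Mstar, B9Thm312Whole.Ops (geo9Y x) (bg9YR (Matrix (Fin N) (Fin N) ℂ) (specialUnitaryUnits (Fin N)) R₁ R₂ x)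
      (XBK (TrIdx N) x.toKIdx) (XBK (TrIdx N) x.toKIdx) (XHK (TrIdx N) x.toKIdx) (XSK (TrIdx N) x.toKIdx))
    (bH13 : ∀ x : MemberY d ℓ hd hL b₀ b₁ Mstar, (bg9YR (Matrix (Fin N) (Fin N) ℂ) (specialUnitaryUnits (Fin N)) R₁ R₂ x).Cfg → BlockNorm (toB6 (geo9Y x) 1 (H x)) (XSK (TrIdx N) x.toKIdx → ℝ)) (Bq12 : ℝ → ℝ) (hBq12 : ∀ β, 0 ≤ Bq12 β)
    {B12₀ δ12₀ B12₃ δ12₃ M₀ a₀ c35 : ℝ} {Bh12 Bi12 : ℝ → ℝ} {Bi2₁₂ : ℝ → ℝ → ℝ}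
    (hB12₃ : 0 ≤ B12₃) (hBh12 : ∀ β, 0 ≤ β → β < 1 → 0 ≤ Bh12 β) (hδ12₃ : 0 ≤ δ12₃) (hδ₃₀ : δ12₃ ≤ δ12₀)
    -- [CASCADE-K K2] THE AVERAGING LETTER's `Q⋆`-MAJORANT AT THE MEMBER, DISPLAYED (today: dag-n06-w5's `hasMaj_Qstar_pins` at the straight pair, (3.24); knit: dag-n06-c's (L7) sizes of `Q†`) — rate `δQ ≥ δ12₃ + 1`, constant `BQ ≥ 0`
    (BQ δQ : ℝ) (hBQ : 0 ≤ BQ) (hδQ : δ12₃ + 1 ≤ δQ)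
    (hqsK : ∀ x : MemberY d ℓ hd hL b₀ b₁ Mstar, M₀ ≤ (geo9Y x).M → ∀ α₀ : ℝ, 0 < α₀ → (geo9Y x).M * α₀ ≤ a₀ →
      ∀ U : (bg9YR (Matrix (Fin N) (Fin N) ℂ) (specialUnitaryUnits (Fin N)) R₁ R₂ x).Cfg, (bg9YR (Matrix (Fin N) (Fin N) ℂ) (specialUnitaryUnits (Fin N)) R₁ R₂ x).Reg335 c35 α₀ U →
        HasMaj (weightNorm (BlockNorm.ofBlocks (toB6 (geo9Y x) 1 (H x)) (𝔬12 x).blkZ) (fun y => ((((ℓ + 1 : ℕ) : ℝ) ^ (d + 1)) ^ lvl x.hN x.D x.hk y)⁻¹) (fun y => (plateau_pos x.toKIdx y).le))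
          (cNorm 1 (H x) (𝔬12 x).blk (fun y => (geo9Y_len_pos x y).le) 0) ((𝔬12 x).Qstar U) (fun a a' => BQ * Real.exp (-(δQ * (geo9Y x).dist a a'))))
    (h33 : ∀ x : MemberY d ℓ hd hL b₀ b₁ Mstar, M₀ ≤ (geo9Y x).M → ∀ α₀ : ℝ, 0 < α₀ → (geo9Y x).M * α₀ ≤ a₀ →
      ∀ U : (bg9YR (Matrix (Fin N) (Fin N) ℂ) (specialUnitaryUnits (Fin N)) R₁ R₂ x).Cfg,
        (bg9YR (Matrix (Fin N) (Fin N) ℂ) (specialUnitaryUnits (Fin N)) R₁ R₂ x).Reg335 c35 α₀ U →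
        (bg9YR (Matrix (Fin N) (Fin N) ℂ) (specialUnitaryUnits (Fin N)) R₁ R₂ x).Reg336 c35 α₀ U →
          Thm33G0Dir (𝔬12 x) (𝔭A x) (Dd x) (Dds x) 1 (H x) (bHXA x) B12₀ Bh12 Bi12 Bi2₁₂ δ12₀ U) :
    ∃ (MQ : ℝ) (Bq : ℝ → ℝ), (∀ β, 0 ≤ Bq β) ∧
      (∀ x : MemberY d ℓ hd hL b₀ b₁ Mstar, MQ ≤ (geo9Y x).M → ∀ α₀ : ℝ, 0 < α₀ → (geo9Y x).M * α₀ ≤ a₀ →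
        ∀ U : (bg9YR (Matrix (Fin N) (Fin N) ℂ) (specialUnitaryUnits (Fin N)) R₁ R₂ x).Cfg,
          (bg9YR (Matrix (Fin N) (Fin N) ℂ) (specialUnitaryUnits (Fin N)) R₁ R₂ x).Reg335 c35 α₀ U →
          (bg9YR (Matrix (Fin N) (Fin N) ℂ) (specialUnitaryUnits (Fin N)) R₁ R₂ x).Reg336 c35 α₀ U →
            LettersHHZ (𝔬12 x) (𝔭A x) 1 (H x) (fun y => (geo9Y_len_pos x y).le)
              (weightNorm (BlockNorm.ofBlocks (toB6 (geo9Y x) 1 (H x)) (𝔬12 x).blkZ) (fun y => ((((ℓ + 1 : ℕ) : ℝ) ^ (d + 1)) ^ lvl x.hN x.D x.hk y)⁻¹)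
                (fun y => (plateau_pos x.toKIdx y).le)) Bq δ12₃ U) ∧
      (∀ (x : MemberY d ℓ hd hL b₀ b₁ Mstar) (U : (bg9YR (Matrix (Fin N) (Fin N) ℂ) (specialUnitaryUnits (Fin N)) R₁ R₂ x).Cfg),
        Letters313DMZ (𝔬12 x) (𝔭A x) (Dd x) 1 (H x) ⟨geo9Y_dist_triangle x, geo9Y_dist_comm x, geo9K_dist_nonneg x.toKIdx, geo9Y_len_pos x⟩
            (fun y => ((((ℓ + 1 : ℕ) : ℝ) ^ (d + 1)) ^ lvl x.hN x.D x.hk y)⁻¹) (fun y => plateau_pos x.toKIdx y) B12₃ Bq12 δ12₃ (bH13 x U) U →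
          Letters313DMZ (𝔬12 x) (𝔭A x) (Dd x) 1 (H x) ⟨geo9Y_dist_triangle x, geo9Y_dist_comm x, geo9K_dist_nonneg x.toKIdx, geo9Y_len_pos x⟩
            (fun y => ((((ℓ + 1 : ℕ) : ℝ) ^ (d + 1)) ^ lvl x.hN x.D x.hk y)⁻¹) (fun y => plateau_pos x.toKIdx y) B12₃ Bq δ12₃ (bH13 x U) U) := by
  -- [4] (2.61) at rate 1 above ONE threshold, constant floored at 0; the letter `Bq⋆ := max Bq12 (Bh12·BQ·c)` (dag-n06-w5 (c1) with the displayed `Q⋆`-majorant)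
  obtain ⟨ML, c₁, hrow⟩ := rowSum261_geo9Y (d := d) (ℓ := ℓ) (hd := hd) (hL := hL) (b₀ := b₀) (b₁ := b₁) (Mstar := Mstar) 1 one_pos
  refine ⟨max M₀ ML, fun β => max (Bq12 β) (Bh12 β * BQ * max c₁ 0),
    fun β => (hBq12 β).trans (le_max_left _ _), fun x hM α₀ hα ha U hU hU' => ?_, fun x U h => ?_⟩
  · have hrowx : RowSum (toB6 (geo9Y x) 1 (H x)) 1 (max c₁ 0) := fun y => (hrow x ((le_max_right _ _).trans hM) y).trans (le_max_left _ _)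
    have hG : GeoOK (geo9Y x) := ⟨geo9Y_dist_triangle x, geo9Y_dist_comm x, geo9K_dist_nonneg x.toKIdx, geo9Y_len_pos x⟩
    have h33' := h33 x ((le_max_left _ _).trans hM) α₀ hα ha U hU hU'
    exact ⟨fun β' hβ' hβ'1 => pQ_of_h43 hG hrowx (hBh12 β' hβ' hβ'1) hBQ (le_max_right _ _) hδ12₃ hδ₃₀ hδQ (le_max_right _ _) (h33'.h43L β' hβ' hβ'1)
      (hqsK x ((le_max_left _ _).trans hM) α₀ hα ha U hU)⟩
  · exact letters313DMZ_mono _ hB12₃ le_rfl (fun β _ _ => hBq12 β) (fun β _ _ => le_max_left _ _) le_rfl h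

end Summit.QuantumFields.YangMills.BalabanUVNodes.N06HHLegAtPinsPhysRUPar

end
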